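import Summits.ResolutionOfSingularities.ResolutionOfSingularities.Theses.FrobeniusClosing
import HarnessLib

/-!
# Crux `BoundedMilnor` (stmt-ResolutionOfSingularities-16346) — birth skeleton (BC3), line `birth`

Route `ResolutionOfSingularities/FrobeniusClosing` (closing lemma of arithmetic dynamics on the
isolated core). The crux, BY NAME the route decl `FrobeniusClosing.BoundedMilnor` ("NO PUMPING",
card K1, rank 4):

  for every prime `p`, `n ≥ 1`, perfect field `κ` of characteristic `p`, start `c₀`, chart word
  `i` and translation word `t`: if every state `a_m := run c₀ i t m` of the point-blow-up dynamics
  is ISOLATED (`κ[[u]] ⧸ (∂a_m)` finite over `κ`) of multiplicity `p` (cleaned order `≥ p`), then the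
  Milnor-type colength `μ(a_m) = dim_κ κ[[u]] ⧸ (∂₁a_m, …, ∂ₙa_m)` is bounded in `m`.

(`μ(a) = τ(z^p − a)/p` is the Tjurina number of the purely inseparable atom `z^p = a`; it is an
invariant of the pair class `[a]` under `a ↦ vᵖ·(a ∘ φ) + gᵖ`, since `∂(gᵖ) = 0`.)

## The cut (two named stubs; `BoundedMilnor_of` = stub statements ⇒ crux, sorry-free)

The classical anatomy of a bounded orbit — BOUNDED JUMPS + RECURRENCE — made uniform in `(p, n)`,
which is the shape the route's finite-type arenas `W_β` (ClosingReduction) predict: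

* `stub_successorBound` — **ONE FORCED STEP CANNOT PUMP `μ` BY AN UNBOUNDED AMOUNT (known-type,
  L/XL).** There is `Φ = Φ_{p,n} : ℕ → ℕ` such that for consecutive isolated multiplicity-`p` states
  `μ(a_{m+1}) ≤ Φ(μ(a_m))`, over every perfect field. Proof route (all ingredients in print):
  (J1) the multiset of successor colengths is an invariant of the contact class of the pointed
  hypersurface germ `X = {zᵖ = a}` — the dynamics enumerates exactly the infinitely near points of
  `X` on the blow-up of the closed point (chart `u_i`, point `u'_j = τ_j`, the `z'`-translation being
  the deletion of the constant term by cleaning, `κ` perfect), and `μ(successor) = τ(X', P̃)/p`;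
  (J2) finite determinacy (BoubakriGreuelMarkwig2010, arXiv:1005.4503 §1: `μ < ∞ ⇒` right
  `(2μ − ord + 2)`-determined) makes `a_m` pair-isomorphic to a POLYNOMIAL of degree `≤ 2μ + 2`, whose
  successors are polynomials of degree `≤ 4μ + 4` with coefficients polynomial in (coefficients,
  `τ`); (J3) on the universal (Noetherian) parameter space over `𝔽_p` the function `x ↦ μ(b_x)` is
  upper semicontinuous (`{μ ≥ k}` closed: `length R⧸(J + 𝔪ᵏ) ≥ min(k, length R⧸J)` reduces it to
  the corank of a matrix of polynomials; semicontinuity of `μ`, `τ` in families of formal power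
  series: Greuel–Pfister arXiv:1912.05263), the closed sets `{μ ≥ k}` stabilise, so the finite values
  of `μ` on it are bounded — by `Φ(μ₀)`; `μ` is invariant under ground-field extension. This is
  also the statement that the successor correspondence maps the arena `W_β` into `W_{Φ(β)}`.
* `stub_amortisedDrop` — **RETURN LAW ABOVE A THRESHOLD (OPEN — the crux's content, load-bearing).**
  There are `β₀ = β₀(p,n)` and `L = L(p,n)` such that along every infinite isolated
  multiplicity-`p` chain, from any time `m` with `μ(a_m) ≥ β₀` the colength returns weakly below its
  level within `L` steps: `∃ k ∈ (0, L], μ(a_{m+k}) ≤ μ(a_m)`. It is NOT monotonicity (refuted in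
  kind by the spine card's toy C: `p = 3, n = 4`, a verified forced isolated step with `μ_H` rising
  `9 → 12 → 10`), and it is not implied by the crux (uniform thresholds); it says rises are a
  bounded-complexity, bounded-duration phenomenon. `p = 2` looks like `L = 1, β₀ = 0` (toy B: `μ`
  drops at every forced step, ≈290 steps, `n = 3,4,5`). Why it might fail: a sustained pump — an
  infinite isolated chain with windows of every length along which `μ` stays above its entry level
  at arbitrarily high levels (an isolated analogue of Hauser–Perlega's residual-order growth,
  arXiv:1802.05010 §4); such a chain refutes this stub and, with `stub_successorBound` proved, the
  crux itself.

Composition `BoundedMilnor_of : SuccessorBound → AmortisedDrop → BoundedMilnor` (sorry-free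
closure; axioms propext · Classical.choice · Quot.sound): the abstract lemma
`bounded_of_jump_of_drop` — regularise `Φ` to a monotone inflationary `Ψ`; maintain an ANCHOR
`a ≤ m ≤ a + L` with `μ(a_a) ≤ B₁ := max (μ(a_0)) (Ψ β₀)` (when the window expires, the return law
gives the next anchor if `μ(a_a) ≥ β₀`, else `a + 1` is one, of level `≤ Ψ β₀`); then
`μ(a_m) ≤ Ψ^[L] B₁` for all `m` — applied to `f m := mu (run c₀ i t m)` after introducing the
crux's thirteen `let`s (the stub statements carry the crux's `let`-prefix verbatim, so the
identification is definitional). `BoundedMilnor_proof : BoundedMilnor` plugs the two stubs in.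

Disproof used: none exists for this crux (`ledger crux ls stmt-ResolutionOfSingularities-16346`: no
workfiles; `ledger negatives --problem ResolutionOfSingularities`: 1 refuted statement — DefectlessFrames,
stmt-19085, valuation-theoretic, no object in common with this crux). Refuter's ARENA
SHARPENING (evidence on the item, 2026-08-16T19:32Z) honoured: for `n ≥ 3` consecutive isolated
multiplicity-`p` states have cleaned order exactly `p` and successors sit at ridge-vertex points —
consistent with (J2)'s degree bookkeeping and the natural place to look for `β₀, L`; the arena is
non-empty (2-step chains exist), so the local form of `stub_successorBound` has content now.

BC3 audit (this file): `lean check` rc 0; sorries = 2 = {`stub_successorBound`, `stub_amortisedDrop`};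
zero elsewhere (`bounded_of_jump_of_drop`, `BoundedMilnor_of` sorry-free). Probes
(`bc/birth_probe_*.lean`: `Stub → BoundedMilnor`, `Stub → ResolutionOfSingularities` by
`first | exact? | simpa [Stub] | (unfold Stub; simpa) | aesop`) must FAIL for both stubs — see birth.md.
-/

-- single-problem summit: the doubled namespace component `ResolutionOfSingularities` is forced
set_option linter.dupNamespace false

noncomputable section

open Summit.ResolutionOfSingularities.ResolutionOfSingularities.Theses.FrobeniusClosing

namespace Summit.ResolutionOfSingularities.ResolutionOfSingularities.Cruxes.BoundedMilnor.Lines.Birth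

/-! ## The two stub statements as named propositions

Both carry the crux's `let`-prefix VERBATIM (the inlined point-blow-up dynamics `clean, bl, ord, dv,
tr, step, run`, the series/Jacobian vocabulary `ser, pd, jac` and the predicates `Isol, MultP, mu` of
`FrobeniusClosing.BoundedMilnor`), so that after `intro` of the crux's binders the identification with
the crux's own `let`s is definitional. -/

/-- **Statement of `stub_successorBound` (uniform one-step bound).** For every prime `p` and `n ≥ 1`
there is `Φ : ℕ → ℕ` such that over every perfect field of characteristic `p`, for every run of the
point-blow-up dynamics and every `m` with the states at `m` and `m+1` both isolated of multiplicity
`p`, `μ(a_{m+1}) ≤ Φ(μ(a_m))`. [cite: BoubakriGreuelMarkwig2010, §1 (finite determinacy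
`2μ − ord + 2`, arXiv:1005.4503); arXiv:1912.05263 (Greuel–Pfister, semicontinuity of `μ`, `τ` in
families of formal power series)] -/
def SuccessorBound : Prop :=
  ∀ p : ℕ, p.Prime → ∀ n : ℕ, 0 < n → ∃ Φ : ℕ → ℕ, ∀ (κ : Type) [Field κ] [CharP κ p] [PerfectField κ] (c₀ : (Fin n → ℕ) → κ) (i : ℕ → Fin n) (t : ℕ → Fin n → κ), let clean : ((Fin n → ℕ) → κ) → ((Fin n → ℕ) → κ) := fun c A => @ite κ (∀ j, p ∣ A j) (Classical.dec _) 0 (c A); let bl : Fin n → ((Fin n → ℕ) → κ) → ((Fin n → ℕ) → κ) := fun i c B => @ite κ (Finset.sum (Finset.univ.erase i) (fun j => B j) ≤ B i) (Classical.dec _) (c (Function.update B i (B i - Finset.sum (Finset.univ.erase i) (fun j => B j)))) 0; let ord : ((Fin n → ℕ) → κ) → ℕ := fun c => sInf {m : ℕ | ∃ A, c A ≠ 0 ∧ m = Finset.sum Finset.univ (fun j => A j)}; let dv : Fin n → ℕ → ((Fin n → ℕ) → κ) → ((Fin n → ℕ) → κ) := fun i s c B => c (Function.update B i (B i + s)); let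 tr : Fin n → (Fin n → κ) → ℕ → ((Fin n → ℕ) → κ) → ((Fin n → ℕ) → κ) := fun i τ s c B => Finset.sum (Fintype.piFinset (fun _ : Fin n => Finset.range (B i + s + 1))) (fun D => @ite κ (D i = 0) (Classical.dec _) (c (B + D) * Finset.prod (Finset.univ.erase i) (fun j => ((Nat.choose (B j + D j) (B j) : ℕ) : κ) * τ j ^ (D j))) 0); let step : Fin n → (Fin n → κ) → ((Fin n → ℕ) → κ) → ((Fin n → ℕ) → κ) := fun i τ c => clean (tr i τ (@ite ℕ (p ≤ ord (clean c)) (Classical.dec _) p 0) (dv i (@ite ℕ (p ≤ ord (clean c)) (Classical.dec _) p 0) (bl i (clean c)))); let run : ((Fin n → ℕ) → κ) → (ℕ → Fin n) → (ℕ → Fin n → κ) → ℕ → ((Fin n → ℕ) → κ) := fun c₀ i t m => @Nat.rec (fun _ => (Fin n → ℕ) → κ) c₀ (fun m c => step (i m) (t m) c) m; let ser : ((Fin n → ℕ) → κ) → MvPowerSeries (Fin n) κ := fun c => show MvPowerSeries (Fin n) κ from fun A : Fin n →₀ ℕ => clean c ⇑A; let pd : Fin n → MvPowerSeries (Fin n)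 κ → MvPowerSeries (Fin n) κ := fun i f => show MvPowerSeries (Fin n) κ from fun A : Fin n →₀ ℕ => ((A i + 1 : ℕ) : κ) * f (A + Finsupp.single i 1); let jac : ((Fin n → ℕ) → κ) → Ideal (MvPowerSeries (Fin n) κ) := fun c => Ideal.span (Set.range (fun i => pd i (ser c))); let Isol : ((Fin n → ℕ) → κ) → Prop := fun c => Module.Finite κ (MvPowerSeries (Fin n) κ ⧸ jac c); let MultP : ((Fin n → ℕ) → κ) → Prop := fun c => (∃ A, clean c A ≠ 0) ∧ ∀ A, clean c A ≠ 0 → p ≤ Finset.sum Finset.univ (fun j => A j); let mu : ((Fin n → ℕ) → κ) → ℕ := fun c => Module.finrank κ (MvPowerSeries (Fin n) κ ⧸ jac c); ∀ m, Isol (run c₀ i t m) ∧ MultP (run c₀ i t m) → Isol (run c₀ i t (m + 1)) ∧ MultP (run c₀ i t (m + 1)) → mu (run c₀ i t (m + 1)) ≤ Φ (mu (run c₀ i t m))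

/-- **Statement of `stub_amortisedDrop` (return law above a threshold; OPEN).** For every prime `p`
and `n ≥ 1` there are `β₀ L : ℕ` such that over every perfect field of characteristic `p`, along
every INFINITE chain of isolated multiplicity-`p` states, from every time `m` with `β₀ ≤ μ(a_m)` the
colength returns weakly below its level within `L` steps: `∃ k, 0 < k ≤ L ∧ μ(a_{m+k}) ≤ μ(a_m)`.
[cite: arXiv:1802.05010, §1 and §4 (no forced cycles known; unforced runs pump residual order);
BoubakriGreuelMarkwig2010, §1] -/
def AmortisedDrop : Prop :=
  ∀ p : ℕ, p.Prime → ∀ n : ℕ, 0 < n → ∃ β₀ L : ℕ, ∀ (κ : Type) [Field κ] [CharP κ p] [PerfectField κ] (c₀ : (Fin n → ℕ) → κ) (i : ℕ → Fin n) (t : ℕ → Fin n → κ), let clean : ((Fin n → ℕ) → κ) → ((Fin n → ℕ) → κ) := fun c A => @ite κ (∀ j, p ∣ A j) (Classical.dec _) 0 (c A); let bl : Fin n → ((Fin n → ℕ) → κ) → ((Fin n → ℕ) → κ) := fun i c B => @ite κ (Finset.sum (Finset.univ.erase i) (fun j => B j) ≤ B i) (Classical.dec _) (c (Function.update B i (B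 i - Finset.sum (Finset.univ.erase i) (fun j => B j)))) 0; let ord : ((Fin n → ℕ) → κ) → ℕ := fun c => sInf {m : ℕ | ∃ A, c A ≠ 0 ∧ m = Finset.sum Finset.univ (fun j => A j)}; let dv : Fin n → ℕ → ((Fin n → ℕ) → κ) → ((Fin n → ℕ) → κ) := fun i s c B => c (Function.update B i (B i + s)); let tr : Fin n → (Fin n → κ) → ℕ → ((Fin n → ℕ) → κ) → ((Fin n → ℕ) → κ) := fun i τ s c B => Finset.sum (Fintype.piFinset (fun _ : Fin n => Finset.range (B i + s + 1))) (fun D => @ite κ (D i = 0) (Classical.dec _) (c (B + D) * Finset.prod (Finset.univ.erase i) (fun j => ((Nat.choose (B j + D j) (B j) : ℕ) : κ) * τ j ^ (D j))) 0); let step : Fin n → (Fin n → κ) → ((Fin n → ℕ) → κ) → ((Fin n → ℕ) → κ) := fun i τ c => clean (tr i τ (@ite ℕ (p ≤ ord (clean c)) (Classical.dec _) p 0) (dv i (@ite ℕ (p ≤ ord (clean c)) (Classical.dec _) p 0) (bl i (clean c)))); let run : ((Fin n → ℕ) → κ) → (ℕ → Fin n) → (ℕ → Fin n → κ) → ℕ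 → ((Fin n → ℕ) → κ) := fun c₀ i t m => @Nat.rec (fun _ => (Fin n → ℕ) → κ) c₀ (fun m c => step (i m) (t m) c) m; let ser : ((Fin n → ℕ) → κ) → MvPowerSeries (Fin n) κ := fun c => show MvPowerSeries (Fin n) κ from fun A : Fin n →₀ ℕ => clean c ⇑A; let pd : Fin n → MvPowerSeries (Fin n) κ → MvPowerSeries (Fin n) κ := fun i f => show MvPowerSeries (Fin n) κ from fun A : Fin n →₀ ℕ => ((A i + 1 : ℕ) : κ) * f (A + Finsupp.single i 1); let jac : ((Fin n → ℕ) → κ) → Ideal (MvPowerSeries (Fin n) κ) := fun c => Ideal.span (Set.range (fun i => pd i (ser c))); let Isol : ((Fin n → ℕ) → κ) → Prop := fun c => Module.Finite κ (MvPowerSeries (Fin n) κ ⧸ jac c); let MultP : ((Fin n → ℕ) → κ) → Prop := fun c => (∃ A, clean c A ≠ 0) ∧ ∀ A, clean c A ≠ 0 → p ≤ Finset.sum Finset.univ (fun j => A j); let mu : ((Fin n → ℕ) → κ) → ℕ := fun c => Module.finrank κ (MvPowerSeries (Fin n) κ ⧸ jac c); (∀ m, Isol (run c₀ i t m) ∧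 MultP (run c₀ i t m)) → ∀ m, β₀ ≤ mu (run c₀ i t m) → ∃ k, 0 < k ∧ k ≤ L ∧ mu (run c₀ i t (m + k)) ≤ mu (run c₀ i t m)

/-! ## The stubs -/

/-- **Stub 1 (known-type, L/XL): one forced step cannot pump `μ` unboundedly.** See
`SuccessorBound` and the module docstring (J1)–(J3): contact invariance of the successor
colengths, finite determinacy (polynomial representatives of degree `≤ 2μ+2`, successors of degree
`≤ 4μ+4`), upper semicontinuity of `μ` on the universal Noetherian parameter space over `𝔽_p` and
stabilisation of the closed sets `{μ ≥ k}`. [cite: BoubakriGreuelMarkwig2010, §1;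
arXiv:1912.05263] -/
theorem stub_successorBound : SuccessorBound := by
  sorry

/-- **Stub 2 (OPEN, load-bearing): the return law above a threshold.** See `AmortisedDrop`.
Intended mechanisms: a partial budget in the order-`p` window (refuter's arena sharpening: for
`n ≥ 3` all chain states have cleaned order exactly `p` and successors sit at ridge-vertex points
of `F_p mod span{u_jᵖ}`), e.g. a weighted/Hasse–Jacobian colength that drops at every forced step
outside a bounded family of low-complexity configurations (where the observed rise `9 → 12 → 10`
lives); why it might fail: a sustained isolated pump at arbitrarily high level.
[cite: arXiv:1802.05010, §4; BoubakriGreuelMarkwig2010, §1] -/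
theorem stub_amortisedDrop : AmortisedDrop := by
  sorry

/-! ## The composition: bounded jumps + return law ⇒ bounded (abstract, sorry-free) -/

/-- Running-max regularisation of a jump bound: monotone, inflationary, and `≥ Φ`. [folklore] -/
def reg (Φ : ℕ → ℕ) (x : ℕ) : ℕ := max x ((Finset.range (x + 1)).sup Φ)

theorem le_reg_self (Φ : ℕ → ℕ) (x : ℕ) : x ≤ reg Φ x := le_max_left _ _

theorem le_reg (Φ : ℕ → ℕ) (x : ℕ) : Φ x ≤ reg Φ x :=
  le_max_of_le_right (Finset.le_sup (f := Φ) (Finset.self_mem_range_succ x))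

theorem reg_mono (Φ : ℕ → ℕ) : Monotone (reg Φ) := by
  intro x y hxy
  unfold reg
  exact max_le_max hxy (Finset.sup_mono (Finset.range_mono (Nat.succ_le_succ hxy)))

/-- Iterating a monotone jump bound along the sequence. [folklore] -/
theorem le_iterate_of_jump {f : ℕ → ℕ} {Ψ : ℕ → ℕ} (hmono : Monotone Ψ)
    (hjump : ∀ m, f (m + 1) ≤ Ψ (f m)) (a r : ℕ) : f (a + r) ≤ Ψ^[r] (f a) := by
  induction r with
  | zero => simp
  | succ r ih =>
    calc f (a + (r + 1)) = f (a + r + 1) := by rw [Nat.add_assoc]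
      _ ≤ Ψ (f (a + r)) := hjump _
      _ ≤ Ψ (Ψ^[r] (f a)) := hmono ih
      _ = Ψ^[r + 1] (f a) := (Function.iterate_succ_apply' Ψ r (f a)).symm

/-- **Bounded jumps + return law above a threshold ⇒ bounded** (the combinatorial heart of the
line). If `f (m+1) ≤ Φ (f m)` for all `m`, and from every level `≥ β₀` the sequence returns weakly
below that level within `L` steps, then `f` is bounded (by `Ψ^[L] (max (f 0) (Ψ β₀))`, `Ψ` the
running-max regularisation of `Φ`). [folklore] -/
theorem bounded_of_jump_of_drop (f : ℕ → ℕ) (Φ : ℕ → ℕ) (hjump : ∀ m, f (m + 1) ≤ Φ (f m))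
    (β₀ L : ℕ) (hdrop : ∀ m, β₀ ≤ f m → ∃ k, 0 < k ∧ k ≤ L ∧ f (m + k) ≤ f m) :
    ∃ B : ℕ, ∀ m, f m ≤ B := by
  -- regularise the jump bound
  obtain ⟨Ψ, hmono, hinfl, hjump'⟩ :
      ∃ Ψ : ℕ → ℕ, Monotone Ψ ∧ (∀ x, x ≤ Ψ x) ∧ ∀ m, f (m + 1) ≤ Ψ (f m) :=
    ⟨reg Φ, reg_mono Φ, le_reg_self Φ, fun m => (hjump m).trans (le_reg Φ _)⟩
  -- the anchor level
  obtain ⟨B₁, h0, hβ⟩ : ∃ B₁ : ℕ, f 0 ≤ B₁ ∧ Ψ β₀ ≤ B₁ :=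
    ⟨max (f 0) (Ψ β₀), le_max_left _ _, le_max_right _ _⟩
  -- invariant: an anchor `a` of level `≤ B₁` at distance `≤ L` behind `m`
  have key : ∀ m, ∃ a, a ≤ m ∧ m ≤ a + L ∧ f a ≤ B₁ := by
    intro m
    induction m with
    | zero => exact ⟨0, le_rfl, Nat.zero_le _, h0⟩
    | succ m ih =>
      obtain ⟨a, ham, hma, hfa⟩ := ih
      by_cases h : m + 1 ≤ a + L
      · exact ⟨a, ham.trans (Nat.le_succ m), h, hfa⟩
      · by_cases hb : β₀ ≤ f a
        · obtain ⟨k, hk0, hkL, hfk⟩ := hdrop a hb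
          exact ⟨a + k, by omega, by omega, hfk.trans hfa⟩
        · refine ⟨a + 1, by omega, by omega, ?_⟩
          calc f (a + 1) ≤ Ψ (f a) := hjump' a
            _ ≤ Ψ β₀ := hmono (le_of_lt (not_le.mp hb))
            _ ≤ B₁ := hβ
  refine ⟨Ψ^[L] B₁, fun m => ?_⟩
  obtain ⟨a, ham, hma, hfa⟩ := key m
  obtain ⟨r, rfl⟩ := Nat.exists_eq_add_of_le ham
  have hr : r ≤ L := by omega
  calc f (a + r) ≤ Ψ^[r] (f a) := le_iterate_of_jump hmono hjump' a r
    _ ≤ Ψ^[r] B₁ := (hmono.iterate r) hfa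
    _ ≤ Ψ^[L] B₁ := (hmono.monotone_iterate_of_le_map (hinfl B₁)) hr

/-! ## The crux from the two stub STATEMENTS (sorry-free closure), and the skeleton theorem -/

/-- **`BoundedMilnor` from the two stub statements — the reduction itself, kernel-checked with NO
`sorry` in its closure.** Introduce the crux's binders and its thirteen `let`s; the stub statements
(same `let`-prefix, instantiated at the same `p, n, κ, c₀, i, t`) specialise definitionally to the
jump bound and the return law for `f m := mu (run c₀ i t m)`; conclude by `bounded_of_jump_of_drop`.
[folklore] -/
theorem BoundedMilnor_of : SuccessorBound → AmortisedDrop → BoundedMilnor := by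
  intro hJ hD p hp n hn κ _ _ _ c₀ i t
  obtain ⟨Φ, hJ'⟩ := hJ p hp n hn
  obtain ⟨β₀, L, hD'⟩ := hD p hp n hn
  have hJ'' := hJ' κ c₀ i t
  have hD'' := hD' κ c₀ i t
  intro clean bl ord dv tr step run ser pd jac Isol MultP mu hchain
  exact bounded_of_jump_of_drop (fun m => mu (run c₀ i t m)) Φ
    (fun m => hJ'' m (hchain m) (hchain (m + 1))) β₀ L (hD'' hchain)

/-- **The crux `BoundedMilnor`, assembled from the two registered stubs** (the skeleton in its final
shape; the only `sorry`s in its closure are `stub_successorBound` and `stub_amortisedDrop`). -/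
theorem BoundedMilnor_proof : BoundedMilnor :=
  BoundedMilnor_of stub_successorBound stub_amortisedDrop

end Summit.ResolutionOfSingularities.ResolutionOfSingularities.Cruxes.BoundedMilnor.Lines.Birth

end
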